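import Mathlib
import HarnessLib
import Summits.HubbardSuperconductivity.HubbardSuperconductivity.Theorems.KLProgrammeKLRegimeSplitTwoLegSizesMSProfileSizes
import Summits.HubbardSuperconductivity.HubbardSuperconductivity.Theorems.KLProgrammeKLRegimeSplitTwoLegIncrementSizes

/-!
# Route `KLProgramme`, crux K3 — (E3a-MS) supplier: the centred SUP of a curve profile by OSCILLATION, not by `2·sup` (repair «MS-A0»; k3c3-p1 g4)

Seat hubbard-kl-k3c3-p1 (g4), row «δμ-flow with klAngularMean constant piece».  `curveProfile_centred_sizes` (`…MSProfileSizes`, g3) bounds the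
centred angular sizes `‖Dⁱ(p − mean p)‖`, `i ≤ j`, of a curve profile `p = S∘γ` by `bellCum M D j`, whose order-`0` entry is `2·M 0` (`M 0 ≥ sup|S|`).
Through the extension numeral of `norm_iteratedFDeriv_onM_piece_le` that entry enters the size of EVERY derivative of the G-extended piece — and for the
two-leg increment symbol `sup|S| ≍ |U|·16^{−n}` (first order: the tadpole) while its derivatives are `≍ U²·4^{(l−2)n}`: below `n ≍ log₄(1/|U|)` the `2·M 0`
entry dominates the order-`j ≥ 1` budgets `(S_j + S′_j|U|)·U²·4^{(j−2)n}` by `|U|^{−1}4^{−jn}`, so fits keyed on `bellCum` are unsatisfiable there (base AND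
response profiles, every scale incl. the top at small `β`).  The constant piece is exactly what the centring removes: the right order-`0` entry is the
OSCILLATION of `p`, which only sees `p′`:

* `abs_sub_klAngularMean_le_of_osc` — `|p θ − mean p| ≤ ω` whenever `|p θ − p s| ≤ ω` on `[0, 2π]`;
* (imported) `abs_sub_klAngularMean_le_of_deriv` (`…TwoLegIncrementSizes`, p488152 — the same observation at the level of one increment) — for a
  `2π`-periodic differentiable profile with `|p′| ≤ Λ`: `|p θ − mean p| ≤ 2π·Λ`;
* `bellCumOsc M D j := min (2·M 0) (2π·(M 1·D 1)) + Σ_{1 ≤ i ≤ j} bellTerm M D i` and **`curveProfile_centred_sizes_osc`**: the sizes of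
  `curveProfile_centred_sizes` with `bellCum ↦ bellCumOsc` (`≤ bellCum`, so every landed consumer survives by monotonicity: `bellCumOsc_le_bellCum`).

Proofs only; nothing about the model.
-/

noncomputable section

namespace Summit.HubbardSuperconductivity.HubbardSuperconductivity.Theorems.KLRegimeSplit

set_option linter.dupNamespace false -- summit = problem name (single-conjunct summit), D-0017

open Real Finset MeasureTheory Literature.MathematicalPhysics.QuantumLattice Literature.MathematicalPhysics.QuantumLattice.FermiRG
open Summit.HubbardSuperconductivity.HubbardSuperconductivity.Theorems.KLProgrammeLegKernels
open Summit.HubbardSuperconductivity.HubbardSuperconductivity.Theorems.PerturbedFermiCurve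

/-! ## §1 Centred sup by oscillation -/

/-- **Centred sup by oscillation**: if `|p θ − p s| ≤ ω` for all `s ∈ [0, 2π]` then `|p θ − mean p| ≤ ω` (interval-integrable `p`). -/
theorem abs_sub_klAngularMean_le_of_osc {p : ℝ → ℝ} (hp : IntervalIntegrable p volume 0 (2 * π)) {θ ω : ℝ}
    (h : ∀ s ∈ Set.Icc (0 : ℝ) (2 * π), |p θ - p s| ≤ ω) : |p θ - klAngularMean p| ≤ ω := by
  have e : p θ - klAngularMean p = klAngularMean (fun s => p θ - p s) := by
    rw [klAngularMean_sub intervalIntegrable_const hp, klAngularMean_const]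
  rw [e]
  exact abs_klAngularMean_le h

/-! ## §2 The Bell table with the oscillation entry -/

/-- **The cumulative Bell bound with the OSCILLATION entry at order `0`**: `min (2·M 0) (2π·M 1·D 1) + Σ_{1 ≤ i ≤ j} bellTerm M D i`. -/
def bellCumOsc (M D : ℕ → ℝ) (j : ℕ) : ℝ := min (2 * M 0) (2 * π * (M 1 * D 1)) + ∑ i ∈ Ico 1 (j + 1), bellTerm M D i

/-- `bellCumOsc ≤ bellCum` (the oscillation entry is at most `2·M 0`). -/
theorem bellCumOsc_le_bellCum (M D : ℕ → ℝ) (j : ℕ) : bellCumOsc M D j ≤ bellCum M D j := by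
  unfold bellCumOsc bellCum
  have hsplit : ∑ i ∈ range (j + 1), bellTerm M D i = bellTerm M D 0 + ∑ i ∈ Ico 1 (j + 1), bellTerm M D i := by
    rw [Finset.range_eq_Ico, ← Finset.sum_eq_sum_Ico_succ_bot (by omega)]
  rw [hsplit]
  have : min (2 * M 0) (2 * π * (M 1 * D 1)) ≤ bellTerm M D 0 := min_le_left _ _
  linarith

/-- `bellCumOsc ≤ 2π·M 1·D 1 + Σ_{1 ≤ i ≤ j} bellTerm` (the oscillation entry is at most the derivative form). -/
theorem bellCumOsc_le_deriv_form (M D : ℕ → ℝ) (j : ℕ) :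
    bellCumOsc M D j ≤ 2 * π * (M 1 * D 1) + ∑ i ∈ Ico 1 (j + 1), bellTerm M D i := by
  unfold bellCumOsc
  have : min (2 * M 0) (2 * π * (M 1 * D 1)) ≤ 2 * π * (M 1 * D 1) := min_le_right _ _
  linarith

/-- `bellCumOsc` is nonnegative for nonnegative data. -/
theorem bellCumOsc_nonneg {M D : ℕ → ℝ} (hM : ∀ k, 0 ≤ M k) (hD : ∀ i, 0 ≤ D i) (j : ℕ) : 0 ≤ bellCumOsc M D j := by
  unfold bellCumOsc
  have h0 := hM 0; have h1 := hM 1; have d1 := hD 1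
  exact add_nonneg (le_min (by positivity) (by positivity)) (Finset.sum_nonneg fun i _ => bellTerm_nonneg hM hD i)

/-- A positive-order Bell term is below `bellCumOsc`. -/
theorem bellTerm_le_bellCumOsc {M D : ℕ → ℝ} (hM : ∀ k, 0 ≤ M k) (hD : ∀ i, 0 ≤ D i) {i j : ℕ} (hi : 1 ≤ i) (hij : i ≤ j) :
    bellTerm M D i ≤ bellCumOsc M D j := by
  unfold bellCumOsc
  have h0 := hM 0; have h1 := hM 1; have d1 := hD 1
  have hmin : 0 ≤ min (2 * M 0) (2 * π * (M 1 * D 1)) := le_min (by positivity) (by positivity)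
  have hs : bellTerm M D i ≤ ∑ i ∈ Ico 1 (j + 1), bellTerm M D i :=
    Finset.single_le_sum (fun k _ => bellTerm_nonneg hM hD k) (Finset.mem_Ico.mpr ⟨hi, by omega⟩)
  linarith

/-- **CENTRED ANGULAR SIZES OF A CURVE PROFILE, oscillation form.**  As `curveProfile_centred_sizes` with `bellCum ↦ bellCumOsc`: the order-`0`
entry is `min (2·M 0) (2π·M 1·D 1)` — the constant piece of the symbol (the tadpole) no longer enters the derivative sizes. -/
theorem curveProfile_centred_sizes_osc (μ : ℝ) (S C : TrigPolyC4v)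
    (hγ : ContDiff ℝ 4 (fun θ => (WithLp.toLp 2 (klFermiPoint μ C θ) : Momentum))) {M D : ℕ → ℝ}
    (hMnn : ∀ k, 0 ≤ M k) (hDnn : ∀ i, 0 ≤ D i) (hM0 : ∀ q : Momentum, |evalM S q| ≤ M 0)
    (hM : ∀ k, 1 ≤ k → k ≤ 4 → ∀ q : Momentum, ‖iteratedFDeriv ℝ k (evalM S) q‖ ≤ M k)
    (hD : ∀ i, 1 ≤ i → i ≤ 4 → ∀ θ, ‖iteratedDeriv i (fun θ => (WithLp.toLp 2 (klFermiPoint μ C θ) : Momentum)) θ‖ ≤ D i)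
    {j : ℕ} (hj : j ≤ 4) {i : ℕ} (hi : i ≤ j) (t : ℝ) :
    ‖iteratedFDeriv ℝ i (fun t => curveProfile μ S C t - klAngularMean (curveProfile μ S C)) t‖ ≤ bellCumOsc M D j := by
  rcases Nat.eq_zero_or_pos i with rfl | hipos
  · -- order zero: both the `2 M₀` bound and the oscillation bound hold
    rw [norm_iteratedFDeriv_zero, Real.norm_eq_abs]
    have h2M : |curveProfile μ S C t - klAngularMean (curveProfile μ S C)| ≤ 2 * M 0 := by
      have h := curveProfile_centred_sizes μ S C hγ hMnn hDnn hM0 hM hD (j := 0) (Nat.zero_le _) le_rfl t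
      rw [norm_iteratedFDeriv_zero, Real.norm_eq_abs] at h
      simpa [bellCum, bellTerm] using h
    have hosc : |curveProfile μ S C t - klAngularMean (curveProfile μ S C)| ≤ 2 * π * (M 1 * D 1) := by
      have hp : ContDiff ℝ 4 (curveProfile μ S C) := by
        rw [curveProfile_eq_comp]; exact (contDiff_evalM S).comp hγ
      refine abs_sub_klAngularMean_le_of_deriv (hp.differentiable (by norm_num)) (fun θ => ?_) (fun θ => ?_) t
      · simp only [curveProfile, klFermiPoint_periodic μ C θ]
      · have hB := (abs_iteratedDeriv_comp_le_bell (contDiff_evalM S) hγ (θ := θ) (M := M) (D := D)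
          (fun k hk1 hk4 => hM k hk1 hk4 _) (fun i hi1 hi4 => hD i hi1 hi4 θ)).1
        rw [iteratedDeriv_one, ← curveProfile_eq_comp] at hB
        exact hB
    calc |curveProfile μ S C t - klAngularMean (curveProfile μ S C)|
        ≤ min (2 * M 0) (2 * π * (M 1 * D 1)) := le_min h2M hosc
      _ ≤ bellCumOsc M D j := by
          unfold bellCumOsc
          have := Finset.sum_nonneg fun i (_ : i ∈ Ico 1 (j + 1)) => bellTerm_nonneg hMnn hDnn i
          linarith
  · -- positive order: the Bell term, as in `curveProfile_centred_sizes`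
    refine le_trans ?_ (bellTerm_le_bellCumOsc hMnn hDnn hipos hi)
    rw [norm_iteratedFDeriv_eq_norm_iteratedDeriv, Real.norm_eq_abs]
    have e : (fun t => curveProfile μ S C t - klAngularMean (curveProfile μ S C)) =
        fun t => -klAngularMean (curveProfile μ S C) + curveProfile μ S C t := by funext t; ring
    rw [e, iteratedDeriv_const_add hipos, curveProfile_eq_comp]
    have hB := abs_iteratedDeriv_comp_le_bell (contDiff_evalM S) hγ (θ := t) (M := M) (D := D)
      (fun k hk1 hk4 => hM k hk1 hk4 _) (fun i hi1 hi4 => hD i hi1 hi4 t)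
    have hi4 : i ≤ 4 := hi.trans hj
    interval_cases i
    · simpa [bellTerm] using hB.1
    · simpa [bellTerm] using hB.2.1
    · simpa [bellTerm] using hB.2.2.1
    · simpa [bellTerm] using hB.2.2.2

end Summit.HubbardSuperconductivity.HubbardSuperconductivity.Theorems.KLRegimeSplit

end
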